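import Summits.AnomalousDissipation.AnomalousDissipation.Theorems.SolenoidalFractalHomogenisationLagrangianStepDefs
import Summits.AnomalousDissipation.AnomalousDissipation.Theorems.SolenoidalFractalHomogenisationLagrangianStepCellLawVSemigroupPerp
import Literature.Analysis.FluidPDE.QuasiStaticSlotWeight
import Mathlib.MeasureTheory.Integral.DominatedConvergence
import HarnessLib

/-!
# K1L `LagrangianRenormalisationStep(Design)` (K1L_D, stmt-AnomalousDissipation-27980; aside 24912), stub `stub_cellLawV0_IS`
# — W2 (ii): the QUASI-STATIC SLOT RESPONSE `qsResp ρ T B = T ∫₀¹ a(s) ∫₀ˢ a(x) e^{−T(s−x)B} dx ds`, its bilinear form and its pinch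
# (helper; `--supports stmt-AnomalousDissipation-27980`; word-independent)

Summits-side helper file of route `SolenoidalFractalHomogenisation` (planner ad-ideate-p5's STUB-PLAN for `stub_cellLawV`, `LoewnerWindowSketch` S2
«QSPinch», tenure WORKER FIT v2 item W2; second of three files, on top of `…CellLawVSemigroupPerp.lean`).
* `qsResp` — VERBATIM copy of `Cruxes/LagrangianRenormalisationStep/LoewnerWindowSketch.lean` / `SlowGraphSketch.lean` `qsResp` (the Cruxes sketches are not
  importable on the farm, so the Theorems side carries the definition; same short name, same body), and its scalar version `qsRespScalar ρ T a`;
* `sum_sum_mul_qsResp_mul` — the bilinear form of `qsResp` is the double integral of the bilinear form of the kernel `e^{−T(s−x)B}` (interval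
  integrals of finite sums; the outer integrand is continuous by Mathlib's `continuous_parametric_intervalIntegral_of_continuous`); hence it is
  symmetric for symmetric `B` (`…_comm`, by name over ad-lit's `dotProduct_exp_neg_smul_mulVec_comm`, p636892), vanishes across a hyperplane invariant
  under the semigroup (`…_eq_zero`), and is PINCHED — `f_T(b)|v|² ≤ vᵀ f_T(B) v ≤ f_T(a)|v|²` — as soon as the semigroup is, for `T ≥ 0`
  (`sum_sum_mul_qsResp_mul_le` / `le_sum_sum_mul_qsResp_mul`: integrate against the non-negative weights `T a(s) a(x)`, `τ = T(s−x) ≥ 0`);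
* `mul_qsRespScalar_eq_slotWeight` — the scalar identification `a · f_T(a) = ϑ(ρ, T a)` with the registered `slotWeight` (p610007), via
  `LatticeShear.exp_mul_integral_eq_duhamel` (`QuasiStaticSlotWeight`, p636417's file).
Everything PROVED, no named facts, no sorry.  Infrastructure for route-1's rung leaf F-D1.A0 (frontier FORMAL rung); NOT a proof of the stub, of the
crux, of Onsager's conjecture or of anomalous dissipation.  Prover seat `ad-k1l-cellLawV-w1` g0, 2026-08-28.
-/

set_option linter.dupNamespace false

noncomputable section

namespace Summit.AnomalousDissipation.AnomalousDissipation.Theorems.SolenoidalFractalHomogenisation.LagrangianStep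

open Literature.Analysis Literature.Analysis.FluidPDE Literature.Analysis.FunctionSpaces
open Literature.Analysis.ODE.PeriodicAveraging
open MeasureTheory Set

/-! ## §2 The quasi-static slot response `qsResp` and its scalar version -/

section QuasiStatic

/-- The quasi-static SLOT RESPONSE OPERATOR `f_T(B) = T ∫₀¹ a(s) ∫₀ˢ a(x) e^{−T(s−x)B} dx ds` of the unit trapezoid slot with ramp `ρ`
at non-dimensional relaxation `T`, as a matrix function of the (regularised) transverse block `B` (entrywise integrals of the matrix
exponential).  Scalar case: `f_T(x) = ϑ(ρ, T x)/x` (`slotWeight`), so `f_T(1) = ϑ(ρ, T)`; `f_T` is non-increasing and `x f_T(x)`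
non-decreasing in `x > 0`.  (VERBATIM copy of `Cruxes/LagrangianRenormalisationStep/LoewnerWindowSketch.lean` `qsResp`.) -/
def qsResp (ρ T : ℝ) (B : Matrix (Fin 3) (Fin 3) ℝ) : Matrix (Fin 3) (Fin 3) ℝ := fun i j =>
  T * ∫ s in (0:ℝ)..1, LatticeShear.LatticeWord.trapezoid 0 1 ρ s *
    ∫ x in (0:ℝ)..s, LatticeShear.LatticeWord.trapezoid 0 1 ρ x * (NormedSpace.exp (-(T * (s - x)) • B)) i j

/-- The SCALAR quasi-static slot response `f_T(a) = T ∫₀¹ a(s) ∫₀ˢ a(x) e^{−T(s−x)a} dx ds` (`qsResp` at the `1 × 1` block `a`);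
`a · f_T(a) = ϑ(ρ, T a)` (`mul_qsRespScalar_eq_slotWeight`). -/
def qsRespScalar (ρ T a : ℝ) : ℝ :=
  T * ∫ s in (0:ℝ)..1, LatticeShear.LatticeWord.trapezoid 0 1 ρ s *
    ∫ x in (0:ℝ)..s, LatticeShear.LatticeWord.trapezoid 0 1 ρ x * Real.exp (-(T * (s - x)) * a)

/-- The unit slot envelope is continuous. [folklore] -/
theorem continuous_trapezoid_unit (ρ : ℝ) : Continuous fun s => LatticeShear.LatticeWord.trapezoid 0 1 ρ s := by
  unfold LatticeShear.LatticeWord.trapezoid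
  fun_prop

/-- The unit slot envelope is non-negative. [folklore] -/
theorem trapezoid_unit_nonneg (ρ s : ℝ) : 0 ≤ LatticeShear.LatticeWord.trapezoid 0 1 ρ s :=
  le_max_left _ _

/-- Joint continuity of the kernel entries `(s, x) ↦ (e^{−T(s−x)B})ᵢⱼ`. [folklore] -/
theorem continuous_qsKernel_apply (T : ℝ) (B : Matrix (Fin 3) (Fin 3) ℝ) (i j : Fin 3) :
    Continuous fun p : ℝ × ℝ => (NormedSpace.exp (-(T * (p.1 - p.2)) • B)) i j :=
  (continuous_exp_smul_apply B i j).comp (by fun_prop : Continuous fun p : ℝ × ℝ => -(T * (p.1 - p.2)))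

/-- Joint continuity of the bilinear form of the kernel. [folklore] -/
theorem continuous_qsKernel_bilin (T : ℝ) (B : Matrix (Fin 3) (Fin 3) ℝ) (v w : Fin 3 → ℝ) :
    Continuous fun p : ℝ × ℝ => ∑ i, ∑ j, v i * (NormedSpace.exp (-(T * (p.1 - p.2)) • B)) i j * w j :=
  continuous_finsetSum _ fun i _ => continuous_finsetSum _ fun j _ =>
    (continuous_const.mul (continuous_qsKernel_apply T B i j)).mul continuous_const

/-- Finite double sums with constant coefficients commute with the interval integral. [folklore] -/
private theorem integral_sum_sum_mul {f : Fin 3 → Fin 3 → ℝ → ℝ} {a b : ℝ} (c : Fin 3 → Fin 3 → ℝ)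
    (hf : ∀ i j, IntervalIntegrable (f i j) volume a b) :
    ∫ x in a..b, ∑ i, ∑ j, c i j * f i j x = ∑ i, ∑ j, c i j * ∫ x in a..b, f i j x := by
  rw [intervalIntegral.integral_finsetSum]
  · refine Finset.sum_congr rfl fun i _ => ?_
    rw [intervalIntegral.integral_finsetSum]
    · exact Finset.sum_congr rfl fun j _ => intervalIntegral.integral_const_mul _ _
    · exact fun j _ => (hf i j).const_mul _
  · intro i _
    have h := IntervalIntegrable.sum Finset.univ fun j (_ : j ∈ Finset.univ) => (hf i j).const_mul (c i j)
    rw [Finset.sum_fn] at h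
    exact h

/-- **The bilinear form of `qsResp` is the double integral of the bilinear form of the kernel.** [folklore] -/
theorem sum_sum_mul_qsResp_mul (ρ T : ℝ) (B : Matrix (Fin 3) (Fin 3) ℝ) (v w : Fin 3 → ℝ) :
    ∑ i, ∑ j, v i * qsResp ρ T B i j * w j =
      T * ∫ s in (0:ℝ)..1, LatticeShear.LatticeWord.trapezoid 0 1 ρ s *
        ∫ x in (0:ℝ)..s, LatticeShear.LatticeWord.trapezoid 0 1 ρ x *
          ∑ i, ∑ j, v i * (NormedSpace.exp (-(T * (s - x)) • B)) i j * w j := by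
  set α : ℝ → ℝ := fun s => LatticeShear.LatticeWord.trapezoid 0 1 ρ s with hα
  set E : ℝ → ℝ → Fin 3 → Fin 3 → ℝ := fun s x i j => (NormedSpace.exp (-(T * (s - x)) • B)) i j with hE
  have hin : ∀ i j s, IntervalIntegrable (fun x => α x * E s x i j) volume 0 s := fun i j s =>
    ((continuous_trapezoid_unit ρ).mul
      ((continuous_qsKernel_apply T B i j).comp (continuous_const.prodMk continuous_id))).intervalIntegrable _ _
  have hout : ∀ i j, IntervalIntegrable (fun s => α s * ∫ x in (0:ℝ)..s, α x * E s x i j) volume 0 1 := by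
    intro i j
    have hf : Continuous (Function.uncurry fun s x : ℝ => α x * E s x i j) :=
      ((continuous_trapezoid_unit ρ).comp continuous_snd).mul (continuous_qsKernel_apply T B i j)
    exact ((continuous_trapezoid_unit ρ).mul
      (intervalIntegral.continuous_parametric_intervalIntegral_of_continuous (a₀ := 0) hf
        continuous_id)).intervalIntegrable _ _
  -- the right-hand side, integral by integral
  have hinner : ∀ s, ∫ x in (0:ℝ)..s, α x * ∑ i, ∑ j, v i * E s x i j * w j
      = ∑ i, ∑ j, (v i * w j) * ∫ x in (0:ℝ)..s, α x * E s x i j := by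
    intro s
    rw [← integral_sum_sum_mul (fun i j => v i * w j) fun i j => hin i j s]
    refine intervalIntegral.integral_congr fun x _ => ?_
    show α x * ∑ i, ∑ j, v i * E s x i j * w j = ∑ i, ∑ j, (v i * w j) * (α x * E s x i j)
    rw [Finset.mul_sum]
    refine Finset.sum_congr rfl fun i _ => ?_
    rw [Finset.mul_sum]
    refine Finset.sum_congr rfl fun j _ => ?_
    ring
  have houter : ∫ s in (0:ℝ)..1, α s * ∫ x in (0:ℝ)..s, α x * ∑ i, ∑ j, v i * E s x i j * w j
      = ∑ i, ∑ j, (v i * w j) * ∫ s in (0:ℝ)..1, α s * ∫ x in (0:ℝ)..s, α x * E s x i j := by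
    rw [← integral_sum_sum_mul (fun i j => v i * w j) hout]
    refine intervalIntegral.integral_congr fun s _ => ?_
    show α s * (∫ x in (0:ℝ)..s, α x * ∑ i, ∑ j, v i * E s x i j * w j)
      = ∑ i, ∑ j, (v i * w j) * (α s * ∫ x in (0:ℝ)..s, α x * E s x i j)
    rw [hinner s, Finset.mul_sum]
    refine Finset.sum_congr rfl fun i _ => ?_
    rw [Finset.mul_sum]
    refine Finset.sum_congr rfl fun j _ => ?_
    ring
  simp only [qsResp]
  rw [houter, Finset.mul_sum]
  refine Finset.sum_congr rfl fun i _ => ?_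
  rw [Finset.mul_sum]
  refine Finset.sum_congr rfl fun j _ => ?_
  ring

/-- The bilinear form of `qsResp ρ T B` is SYMMETRIC for symmetric `B`. [folklore] -/
theorem sum_sum_mul_qsResp_mul_comm (ρ T : ℝ) {B : Matrix (Fin 3) (Fin 3) ℝ} (hB : B.IsSymm) (v w : Fin 3 → ℝ) :
    ∑ i, ∑ j, v i * qsResp ρ T B i j * w j = ∑ i, ∑ j, w i * qsResp ρ T B i j * v j := by
  rw [sum_sum_mul_qsResp_mul, sum_sum_mul_qsResp_mul]
  congr 1
  refine intervalIntegral.integral_congr fun s _ => ?_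
  congr 1
  refine intervalIntegral.integral_congr fun x _ => ?_
  congr 1
  rw [neg_smul, ← sum_mul_mulVec_eq_sum_sum, ← sum_mul_mulVec_eq_sum_sum]
  exact dotProduct_exp_neg_smul_mulVec_comm hB v w _

/-- The bilinear form of `qsResp ρ T B` VANISHES across a hyperplane invariant under the semigroup. [folklore] -/
theorem sum_sum_mul_qsResp_mul_eq_zero (ρ T : ℝ) {B : Matrix (Fin 3) (Fin 3) ℝ} {u w : Fin 3 → ℝ}
    (h : ∀ τ : ℝ, ∑ i, u i * (NormedSpace.exp (-(τ • B))).mulVec w i = 0) :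
    ∑ i, ∑ j, u i * qsResp ρ T B i j * w j = 0 := by
  rw [sum_sum_mul_qsResp_mul]
  have h0 : ∀ s x : ℝ, ∑ i, ∑ j, u i * (NormedSpace.exp (-(T * (s - x)) • B)) i j * w j = 0 := by
    intro s x
    rw [neg_smul, ← sum_mul_mulVec_eq_sum_sum]
    exact h _
  simp only [h0, mul_zero, intervalIntegral.integral_zero]

/-- **The quasi-static pinch, upper half**: if `vᵀe^{-τB}v ≤ e^{-aτ}|v|²` for all `τ ≥ 0`, then `vᵀ f_T(B) v ≤ f_T(a)|v|²`
(`T ≥ 0`; integrate against the non-negative weights `T a(s) a(x)`, `τ = T(s-x) ≥ 0`). [folklore] -/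
theorem sum_sum_mul_qsResp_mul_le {ρ T : ℝ} (hT : 0 ≤ T) {B : Matrix (Fin 3) (Fin 3) ℝ} {v : Fin 3 → ℝ} {a : ℝ}
    (hv : ∀ τ : ℝ, 0 ≤ τ → ∑ i, v i * (NormedSpace.exp (-(τ • B))).mulVec v i ≤ Real.exp (-(a * τ)) * ∑ i, v i ^ 2) :
    ∑ i, ∑ j, v i * qsResp ρ T B i j * v j ≤ qsRespScalar ρ T a * ∑ i, v i ^ 2 := by
  rw [sum_sum_mul_qsResp_mul]
  unfold qsRespScalar
  rw [mul_assoc]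
  refine mul_le_mul_of_nonneg_left ?_ hT
  rw [← intervalIntegral.integral_mul_const]
  have hsc : Continuous fun p : ℝ × ℝ => Real.exp (-(T * (p.1 - p.2)) * a) := by fun_prop
  refine intervalIntegral.integral_mono_on zero_le_one ?_ ?_ fun s hs => ?_
  · have hf : Continuous (Function.uncurry fun s x : ℝ => LatticeShear.LatticeWord.trapezoid 0 1 ρ x *
        ∑ i, ∑ j, v i * (NormedSpace.exp (-(T * (s - x)) • B)) i j * v j) :=
      ((continuous_trapezoid_unit ρ).comp continuous_snd).mul (continuous_qsKernel_bilin T B v v)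
    exact ((continuous_trapezoid_unit ρ).mul
      (intervalIntegral.continuous_parametric_intervalIntegral_of_continuous (a₀ := 0) hf
        continuous_id)).intervalIntegrable _ _
  · have hf : Continuous (Function.uncurry fun s x : ℝ => LatticeShear.LatticeWord.trapezoid 0 1 ρ x *
        Real.exp (-(T * (s - x)) * a)) :=
      ((continuous_trapezoid_unit ρ).comp continuous_snd).mul hsc
    exact (((continuous_trapezoid_unit ρ).mul
      (intervalIntegral.continuous_parametric_intervalIntegral_of_continuous (a₀ := 0) hf
        continuous_id)).mul continuous_const).intervalIntegrable _ _
  · rw [mul_assoc]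
    refine mul_le_mul_of_nonneg_left ?_ (trapezoid_unit_nonneg ρ s)
    rw [← intervalIntegral.integral_mul_const]
    refine intervalIntegral.integral_mono_on hs.1 ?_ ?_ fun x hx => ?_
    · exact ((continuous_trapezoid_unit ρ).mul
        ((continuous_qsKernel_bilin T B v v).comp (continuous_const.prodMk continuous_id))).intervalIntegrable _ _
    · exact (((continuous_trapezoid_unit ρ).mul
        (hsc.comp (continuous_const.prodMk continuous_id))).mul continuous_const).intervalIntegrable _ _
    · rw [mul_assoc]
      refine mul_le_mul_of_nonneg_left ?_ (trapezoid_unit_nonneg ρ x)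
      have hτ : 0 ≤ T * (s - x) := mul_nonneg hT (by linarith [hx.2])
      have h := hv (T * (s - x)) hτ
      rw [neg_smul, ← sum_mul_mulVec_eq_sum_sum]
      have he : Real.exp (-(T * (s - x)) * a) = Real.exp (-(a * (T * (s - x)))) := by
        congr 1; ring
      rw [he]
      exact h

/-- **The quasi-static pinch, lower half**: if `e^{-bτ}|v|² ≤ vᵀe^{-τB}v` for all `τ ≥ 0`, then `f_T(b)|v|² ≤ vᵀ f_T(B) v`
(`T ≥ 0`). [folklore] -/
theorem le_sum_sum_mul_qsResp_mul {ρ T : ℝ} (hT : 0 ≤ T) {B : Matrix (Fin 3) (Fin 3) ℝ} {v : Fin 3 → ℝ} {b : ℝ}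
    (hv : ∀ τ : ℝ, 0 ≤ τ → Real.exp (-(b * τ)) * ∑ i, v i ^ 2 ≤ ∑ i, v i * (NormedSpace.exp (-(τ • B))).mulVec v i) :
    qsRespScalar ρ T b * ∑ i, v i ^ 2 ≤ ∑ i, ∑ j, v i * qsResp ρ T B i j * v j := by
  rw [sum_sum_mul_qsResp_mul]
  unfold qsRespScalar
  rw [mul_assoc]
  refine mul_le_mul_of_nonneg_left ?_ hT
  rw [← intervalIntegral.integral_mul_const]
  have hsc : Continuous fun p : ℝ × ℝ => Real.exp (-(T * (p.1 - p.2)) * b) := by fun_prop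
  refine intervalIntegral.integral_mono_on zero_le_one ?_ ?_ fun s hs => ?_
  · have hf : Continuous (Function.uncurry fun s x : ℝ => LatticeShear.LatticeWord.trapezoid 0 1 ρ x *
        Real.exp (-(T * (s - x)) * b)) :=
      ((continuous_trapezoid_unit ρ).comp continuous_snd).mul hsc
    exact (((continuous_trapezoid_unit ρ).mul
      (intervalIntegral.continuous_parametric_intervalIntegral_of_continuous (a₀ := 0) hf
        continuous_id)).mul continuous_const).intervalIntegrable _ _
  · have hf : Continuous (Function.uncurry fun s x : ℝ => LatticeShear.LatticeWord.trapezoid 0 1 ρ x *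
        ∑ i, ∑ j, v i * (NormedSpace.exp (-(T * (s - x)) • B)) i j * v j) :=
      ((continuous_trapezoid_unit ρ).comp continuous_snd).mul (continuous_qsKernel_bilin T B v v)
    exact ((continuous_trapezoid_unit ρ).mul
      (intervalIntegral.continuous_parametric_intervalIntegral_of_continuous (a₀ := 0) hf
        continuous_id)).intervalIntegrable _ _
  · rw [mul_assoc]
    refine mul_le_mul_of_nonneg_left ?_ (trapezoid_unit_nonneg ρ s)
    rw [← intervalIntegral.integral_mul_const]
    refine intervalIntegral.integral_mono_on hs.1 ?_ ?_ fun x hx => ?_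
    · exact (((continuous_trapezoid_unit ρ).mul
        (hsc.comp (continuous_const.prodMk continuous_id))).mul continuous_const).intervalIntegrable _ _
    · exact ((continuous_trapezoid_unit ρ).mul
        ((continuous_qsKernel_bilin T B v v).comp (continuous_const.prodMk continuous_id))).intervalIntegrable _ _
    · rw [mul_assoc]
      refine mul_le_mul_of_nonneg_left ?_ (trapezoid_unit_nonneg ρ x)
      have hτ : 0 ≤ T * (s - x) := mul_nonneg hT (by linarith [hx.2])
      have h := hv (T * (s - x)) hτ
      rw [neg_smul, ← sum_mul_mulVec_eq_sum_sum]
      have he : Real.exp (-(T * (s - x)) * b) = Real.exp (-(b * (T * (s - x)))) := by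
        congr 1; ring
      rw [he]
      exact h

/-- **Scalar identification**: `a · f_T(a) = ϑ(ρ, T a)` — the registered `slotWeight` at relaxation `T a`
(`LatticeShear.exp_mul_integral_eq_duhamel`). [folklore] -/
theorem mul_qsRespScalar_eq_slotWeight (ρ T a : ℝ) : a * qsRespScalar ρ T a = slotWeight ρ (T * a) := by
  unfold qsRespScalar slotWeight
  have h : ∀ s : ℝ, Real.exp (-(T * a) * s) * ∫ x in (0:ℝ)..s, Real.exp ((T * a) * x) *
        LatticeShear.LatticeWord.trapezoid 0 1 ρ x
      = ∫ x in (0:ℝ)..s, LatticeShear.LatticeWord.trapezoid 0 1 ρ x * Real.exp (-(T * (s - x)) * a) := by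
    intro s
    rw [LatticeShear.exp_mul_integral_eq_duhamel]
    refine intervalIntegral.integral_congr fun x _ => ?_
    rw [mul_comm]
    congr 1
    ring_nf
  simp_rw [h]
  ring

end QuasiStatic

end Summit.AnomalousDissipation.AnomalousDissipation.Theorems.SolenoidalFractalHomogenisation.LagrangianStep

end
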